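import Summits.CriticalPhenomena.Ising3DConformalLimit.Theorems.EnergyNotSigmaSquaredGapForcesFarMergingSandwichDefs
import Summits.CriticalPhenomena.Ising3DConformalLimit.Theorems.EnergyNotSigmaSquaredGapForcesFarMergingReduction
import Summits.CriticalPhenomena.Ising3DConformalLimit.Theorems.EnergyNotSigmaSquaredGapForcesFarMergingEnergyFactorisation
import HarnessLib

/-!
# One-pinch decay, auxiliary file 2: the infinite-volume bound from GAP, RP un-pinching and MMS
(line `one-cluster-depletion-sandwich` of crux `GapForcesFarMerging`, item stmt-CriticalPhenomena-4468;
helper for the registered stub `stub_onePinchDecay`, lead seat c1)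

At the far octave `K+1` (mirror parameter `m = 2^K`, far point `xR m = 2^{K+1} e₁`, far ends
`p = pFar (K+1) = (2^{K+1}, 0, 2^{K+1})`, `q = qFar (K+1) = (2^{K+1}, 0, -2^{K+1})`, mirror images
`±2^{K+1} e₃`):
1. the landed RP Gram minor `rpUnpinchShape_criticalCorr` gives
   `⟨ε₀ ; σ_pσ_q⟩² ≤ ⟨ε₀ ; ε_{2^{K+1}e₁}⟩ · ⟨σ_{2^{K+1}e₃}σ_{-2^{K+1}e₃} ; σ_pσ_q⟩`;
2. GAP bounds the first factor by `C (2^{K+1})^{-κ} G(2^{K+1}e₁)²`; Griffiths, Lebowitz and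
   Messager–Miracle-Solé in the sup norm (`softPackageNoBubble_criticalCorr`) bound the second by
   `G(2^{K+1}e₁)² + G(2^K e₁)²`;
3. Aizenman's energy factorisation (`energyFactorisation_criticalCorr`) bounds
   `G(0,p) G(e₂,q) (1 - P^{0p,e₂q}_{β_c}[0 ↔ e₂])` by the truncation, and MMS gives
   `G(0,p), G(e₂,q) ≥ G(2^{K+3}e₁)`;
4. inside a doubling window `Doubling θ (K+1)` all these values of `G` are comparable to `G(2^{K+1}e₁)`
   within `θ^{O(1)}`, whence `1 - P^{0p,e₂q}_{β_c}[0 ↔ e₂] ≤ D(C,θ) · (2^{K+1})^{-κ/2}`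
   (`onePinchDecay_one_sub_probInf_le`).
References: Fröhlich–Israel–Lieb–Simon 1978, Thm 2.1 [FILS1978]; Aizenman–Duminil-Copin 2021, eqs. (3.11),
(5.3) [AizenmanDuminilCopinAnnals2021]; Messager–Miracle-Solé 1977 [MessagerMiracleSoleJSP1977];
Lebowitz 1974 [Lebowitz1974].
-/

noncomputable section

namespace Summit.CriticalPhenomena.Ising3DConformalLimit.EnergyNotSigmaSquaredGapForcesFarMergingSandwich

namespace OnePinchDecayProof

open scoped symmDiff
open MeasureTheory Filter
open Literature.Probability.LatticeModels Literature.Probability.Percolation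
open Summit.CriticalPhenomena.Ising3DConformalLimit.GapForcesFarMergingSandwich
open Summit.CriticalPhenomena.Ising3DConformalLimit.Theses.EnergyNotSigmaSquared
open Summit.CriticalPhenomena.Ising3DConformalLimit.Theorems.GapForcesFarMerging.Negative
  (cc2 xR mirror pairCovS softPackageNoBubble_criticalCorr)
open Summit.CriticalPhenomena.Ising3DConformalLimit.EnergyNotSigmaSquaredGapForcesFarMerging
  (rpUnpinchShape_criticalCorr energyFactorisation_criticalCorr)

/-! ## Lattice geometry of the octave `K+1` -/

/-- `2^j e₁` is the coordinate vector `Pi.single 0 (2^j)`. [folklore] -/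
theorem two_pow_smul_e₁ (j : ℕ) : ((2 : ℤ) ^ j) • e₁ = (Pi.single 0 ((2 : ℤ) ^ j) : Site 3) := by
  ext i; fin_cases i <;> simp

/-- `‖2^j e₁‖ = 2^j` (sup norm). [folklore] -/
theorem norm_two_pow_smul_e₁ (j : ℕ) : ‖((2 : ℤ) ^ j) • e₁‖ = (2 : ℝ) ^ j := by
  rw [two_pow_smul_e₁, Pi.norm_single, Int.norm_eq_abs]
  push_cast
  exact abs_of_nonneg (by positivity)

/-- `2^j e₁ ≠ 0`. [folklore] -/
theorem two_pow_smul_e₁_ne_zero (j : ℕ) : ((2 : ℤ) ^ j) • e₁ ≠ 0 := by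
  intro h
  have := congrFun h 0
  simp at this

/-- The far point of the RP minor with mirror parameter `2^K` is `2^{K+1} e₁`. [folklore] -/
theorem xR_two_pow (K : ℕ) : xR (2 ^ K) = ((2 : ℤ) ^ (K + 1)) • e₁ := by
  ext i; fin_cases i <;> simp [xR, pow_succ, mul_comm]

/-- The mirror image of `p_{K+1}` through the site plane `{u₀ = 2^K}` is `2^{K+1} e₃`. [folklore] -/
theorem mirror_pFar (K : ℕ) : mirror (2 ^ K) (pFar (K + 1)) = ((2 : ℤ) ^ (K + 1)) • e₃ := by
  ext i
  fin_cases i <;> simp [mirror, pFar, pow_succ]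
  ring

/-- The mirror image of `q_{K+1}` through the site plane `{u₀ = 2^K}` is `-2^{K+1} e₃`. [folklore] -/
theorem mirror_qFar (K : ℕ) : mirror (2 ^ K) (qFar (K + 1)) = -(((2 : ℤ) ^ (K + 1)) • e₃) := by
  ext i
  fin_cases i <;> simp [mirror, qFar, pow_succ]
  ring

/-- `‖p_K‖ ≤ 2^K`. [folklore] -/
theorem norm_pFar_le (K : ℕ) : ‖pFar K‖ ≤ (2 : ℝ) ^ K := by
  rw [pi_norm_le_iff_of_nonneg (by positivity)]
  intro i; fin_cases i <;> simp [pFar, Int.norm_eq_abs]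

/-- `‖q_K - e₂‖ ≤ 2^K`. [folklore] -/
theorem norm_qFar_sub_e₂_le (K : ℕ) : ‖qFar K - e₂‖ ≤ (2 : ℝ) ^ K := by
  rw [pi_norm_le_iff_of_nonneg (by positivity)]
  intro i; fin_cases i <;> simp [qFar, Int.norm_eq_abs]
  exact one_le_pow₀ (by norm_num)

/-- `2^{K+2} ≤ ‖q_{K+1} - 2^{K+1}e₃‖`. [folklore] -/
theorem le_norm_qFar_sub (K : ℕ) :
    (2 : ℝ) ^ (K + 2) ≤ ‖qFar (K + 1) - ((2 : ℤ) ^ (K + 1)) • e₃‖ := by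
  refine le_trans (le_of_eq ?_) (norm_le_pi_norm _ 2)
  simp [qFar, Int.norm_eq_abs]
  rw [abs_of_nonpos (by nlinarith [pow_pos (show (0:ℝ) < 2 by norm_num) (K + 1)])]
  ring

/-- `2^{K+2} ≤ ‖p_{K+1} + 2^{K+1}e₃‖`. [folklore] -/
theorem le_norm_pFar_add (K : ℕ) :
    (2 : ℝ) ^ (K + 2) ≤ ‖pFar (K + 1) + ((2 : ℤ) ^ (K + 1)) • e₃‖ := by
  refine le_trans (le_of_eq ?_) (norm_le_pi_norm _ 2)
  simp [pFar, Int.norm_eq_abs]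
  rw [abs_of_nonneg (by positivity)]
  ring

/-! ## Messager–Miracle-Solé and the pair correlator -/

/-- MMS in the sup norm for `G = ⟨σ₀σ_·⟩_{β_c}`: `3‖v‖ ≤ ‖w‖ ⟹ G(w) ≤ G(v)`. [cite: AizenmanDuminilCopinAnnals2021, eq. (5.3)] -/
theorem G_le_G {v w : Site 3} (h : 3 * ‖v‖ ≤ ‖w‖) : G w ≤ G v := by
  have hm := softPackageNoBubble_criticalCorr.mms v w h
  rwa [← softPackageNoBubble_criticalCorr.two w, ← softPackageNoBubble_criticalCorr.two v] at hm

/-- `0 < G`. [folklore] -/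
theorem G_pos (x : Site 3) : 0 < G x := by
  have h := softPackageNoBubble_criticalCorr.pos 0 x
  rwa [← softPackageNoBubble_criticalCorr.two x] at h

/-- `G ≤ 1`. [folklore] -/
theorem G_le_one (x : Site 3) : G x ≤ 1 := by
  have h := softPackageNoBubble_criticalCorr.le_one 0 x
  rwa [← softPackageNoBubble_criticalCorr.two x] at h

/-- `⟨σ_aσ_b⟩_{β_c} = G(b - a)`. [folklore] -/
theorem cc2_eq_G (a b : Site 3) : cc2 a b = G (b - a) := criticalCorr_two_pair a b

/-- Dyadic MMS along the first axis: `G(2^{m'}e₁) ≤ G(2^m e₁)` for `m + 2 ≤ m'`. [cite: AizenmanDuminilCopinAnnals2021, eq. (5.3)] -/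
theorem G_dyadic_le {m m' : ℕ} (h : m + 2 ≤ m') :
    G (((2 : ℤ) ^ m') • e₁) ≤ G (((2 : ℤ) ^ m) • e₁) := by
  apply G_le_G
  rw [norm_two_pow_smul_e₁, norm_two_pow_smul_e₁]
  calc (3 : ℝ) * 2 ^ m ≤ 4 * 2 ^ m := by gcongr; norm_num
    _ = 2 ^ (m + 2) := by ring
    _ ≤ 2 ^ m' := pow_le_pow_right₀ (by norm_num) h

/-! ## Step (i): RP un-pinching at the one-pinch configuration, GAP, and the Lebowitz–MMS envelope -/

/-- **The RP Gram minor at the one-pinch configuration** (instance `m = 2^K`, `y = p_{K+1}`,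
`z = q_{K+1}` of the landed `rpUnpinchShape_criticalCorr`):
`⟨ε₀ ; σ_pσ_q⟩² ≤ ⟨ε₀ ; ε_{2^{K+1}e₁}⟩ · ⟨σ_{2^{K+1}e₃}σ_{-2^{K+1}e₃} ; σ_pσ_q⟩`. [cite: FILS1978, Thm. 2.1] -/
theorem rp_pinch (K : ℕ) :
    pairCov 0 e₂ (pFar (K + 1)) (qFar (K + 1)) ^ 2 ≤
      pairCov 0 e₂ (((2 : ℤ) ^ (K + 1)) • e₁) (((2 : ℤ) ^ (K + 1)) • e₁ + e₂) *
        pairCov (((2 : ℤ) ^ (K + 1)) • e₃) (-(((2 : ℤ) ^ (K + 1)) • e₃)) (pFar (K + 1)) (qFar (K + 1)) := by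
  have h := rpUnpinchShape_criticalCorr (2 ^ K) (pFar (K + 1)) (qFar (K + 1))
    (by rw [pFar_apply_zero]; push_cast; exact pow_le_pow_right₀ (by norm_num) (Nat.le_succ K))
    (by rw [qFar_apply_zero]; push_cast; exact pow_le_pow_right₀ (by norm_num) (Nat.le_succ K))
  rw [xR_two_pow, mirror_pFar, mirror_qFar] at h
  exact h

/-- **GAP at the far point `2^j e₁`** (with `C` replaced by `max C 0`):
`⟨ε₀ ; ε_{2^j e₁}⟩ ≤ max(C,0) · (2^j)^{-κ} · G(2^j e₁)²`. [folklore] -/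
theorem gap_at_dyadic {κ C : ℝ}
    (hC : ∀ x : Site 3, x ≠ 0 →
      criticalCorr 3 4 ![0, e₂, x, x + e₂] - criticalCorr 3 2 ![0, e₂] * criticalCorr 3 2 ![x, x + e₂] ≤
        C * (‖x‖ : ℝ) ^ (-κ) * criticalTwoPoint 3 x ^ 2)
    (j : ℕ) :
    pairCov 0 e₂ (((2 : ℤ) ^ j) • e₁) (((2 : ℤ) ^ j) • e₁ + e₂) ≤
      max C 0 * ((2 : ℝ) ^ j) ^ (-κ) * G (((2 : ℤ) ^ j) • e₁) ^ 2 := by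
  have h := hC _ (two_pow_smul_e₁_ne_zero j)
  rw [norm_two_pow_smul_e₁] at h
  refine (le_of_eq_of_le rfl h).trans ?_
  have hr : 0 ≤ ((2 : ℝ) ^ j) ^ (-κ) := Real.rpow_nonneg (by positivity) _
  have hT : 0 ≤ criticalTwoPoint 3 (((2 : ℤ) ^ j) • e₁) ^ 2 := sq_nonneg _
  exact mul_le_mul_of_nonneg_right (mul_le_mul_of_nonneg_right (le_max_left _ _) hr) hT

/-- **Envelope of the un-pinched factor** (Griffiths below, Lebowitz + MMS above): with `t = 2^{K+1}`,
`0 ≤ ⟨σ_{te₃}σ_{-te₃} ; σ_pσ_q⟩ ≤ G(p - te₃)G(q + te₃) + G(q - te₃)G(p + te₃) ≤ G(te₁)² + G(2^K e₁)²`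
(`‖q - te₃‖ = ‖p + te₃‖ = 2^{K+2} ≥ 3·2^K`). [cite: Lebowitz1974, Lebowitz inequality] -/
theorem envelope (K : ℕ) :
    0 ≤ pairCov (((2 : ℤ) ^ (K + 1)) • e₃) (-(((2 : ℤ) ^ (K + 1)) • e₃)) (pFar (K + 1)) (qFar (K + 1)) ∧
    pairCov (((2 : ℤ) ^ (K + 1)) • e₃) (-(((2 : ℤ) ^ (K + 1)) • e₃)) (pFar (K + 1)) (qFar (K + 1)) ≤
      G (((2 : ℤ) ^ (K + 1)) • e₁) ^ 2 + G (((2 : ℤ) ^ K) • e₁) ^ 2 := by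
  have hgr : cc2 (((2 : ℤ) ^ (K + 1)) • e₃) (-(((2 : ℤ) ^ (K + 1)) • e₃)) *
      cc2 (pFar (K + 1)) (qFar (K + 1)) ≤
      criticalCorr 3 4 ![((2 : ℤ) ^ (K + 1)) • e₃, -(((2 : ℤ) ^ (K + 1)) • e₃), pFar (K + 1), qFar (K + 1)] :=
    softPackageNoBubble_criticalCorr.griffiths
      ![((2 : ℤ) ^ (K + 1)) • e₃, -(((2 : ℤ) ^ (K + 1)) • e₃), pFar (K + 1), qFar (K + 1)]
  have hleb : criticalCorr 3 4
        ![((2 : ℤ) ^ (K + 1)) • e₃, -(((2 : ℤ) ^ (K + 1)) • e₃), pFar (K + 1), qFar (K + 1)] -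
      (cc2 (((2 : ℤ) ^ (K + 1)) • e₃) (-(((2 : ℤ) ^ (K + 1)) • e₃)) * cc2 (pFar (K + 1)) (qFar (K + 1)) +
        cc2 (((2 : ℤ) ^ (K + 1)) • e₃) (pFar (K + 1)) * cc2 (-(((2 : ℤ) ^ (K + 1)) • e₃)) (qFar (K + 1)) +
        cc2 (((2 : ℤ) ^ (K + 1)) • e₃) (qFar (K + 1)) * cc2 (-(((2 : ℤ) ^ (K + 1)) • e₃)) (pFar (K + 1))) ≤
      0 :=
    softPackageNoBubble_criticalCorr.lebowitz
      ![((2 : ℤ) ^ (K + 1)) • e₃, -(((2 : ℤ) ^ (K + 1)) • e₃), pFar (K + 1), qFar (K + 1)]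
  -- the four cross correlators
  have h13 : cc2 (((2 : ℤ) ^ (K + 1)) • e₃) (pFar (K + 1)) = G (((2 : ℤ) ^ (K + 1)) • e₁) := by
    rw [cc2_eq_G]; congr 1; simp [pFar]
  have h24 : cc2 (-(((2 : ℤ) ^ (K + 1)) • e₃)) (qFar (K + 1)) = G (((2 : ℤ) ^ (K + 1)) • e₁) := by
    rw [cc2_eq_G]; congr 1; simp [qFar]
  have h14 : cc2 (((2 : ℤ) ^ (K + 1)) • e₃) (qFar (K + 1)) ≤ G (((2 : ℤ) ^ K) • e₁) := by
    rw [cc2_eq_G]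
    apply G_le_G
    rw [norm_two_pow_smul_e₁]
    refine le_trans ?_ (le_norm_qFar_sub K)
    calc (3 : ℝ) * 2 ^ K ≤ 4 * 2 ^ K := by gcongr; norm_num
      _ = 2 ^ (K + 2) := by ring
  have h23 : cc2 (-(((2 : ℤ) ^ (K + 1)) • e₃)) (pFar (K + 1)) ≤ G (((2 : ℤ) ^ K) • e₁) := by
    rw [cc2_eq_G, sub_neg_eq_add]
    apply G_le_G
    rw [norm_two_pow_smul_e₁]
    refine le_trans ?_ (le_norm_pFar_add K)
    calc (3 : ℝ) * 2 ^ K ≤ 4 * 2 ^ K := by gcongr; norm_num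
      _ = 2 ^ (K + 2) := by ring
  have h14' : 0 ≤ cc2 (((2 : ℤ) ^ (K + 1)) • e₃) (qFar (K + 1)) :=
    (softPackageNoBubble_criticalCorr.pos _ _).le
  have h23' : 0 ≤ cc2 (-(((2 : ℤ) ^ (K + 1)) • e₃)) (pFar (K + 1)) :=
    (softPackageNoBubble_criticalCorr.pos _ _).le
  have hprod : cc2 (((2 : ℤ) ^ (K + 1)) • e₃) (qFar (K + 1)) * cc2 (-(((2 : ℤ) ^ (K + 1)) • e₃)) (pFar (K + 1)) ≤
      G (((2 : ℤ) ^ K) • e₁) * G (((2 : ℤ) ^ K) • e₁) :=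
    mul_le_mul h14 h23 h23' (G_pos _).le
  unfold pairCov
  change 0 ≤ criticalCorr 3 4 _ - cc2 _ _ * cc2 _ _ ∧ criticalCorr 3 4 _ - cc2 _ _ * cc2 _ _ ≤ _
  rw [h13, h24] at hleb
  constructor
  · linarith
  · nlinarith

/-! ## Step (ii): energy factorisation -/

/-- **Energy factorisation + positivity** for the one-pinch pair `(0,p)`, `(e₂,q)`:
`0 ≤ 1 - P^{0p,e₂q}_{β_c}[0 ↔ e₂]` and `G(0,p) G(e₂,q) (1 - P^{0p,e₂q}_{β_c}[0 ↔ e₂]) ≤ ⟨ε₀ ; σ_pσ_q⟩`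
(the second cross term of Aizenman's factorisation is nonnegative). [cite: AizenmanDuminilCopinAnnals2021, eq. (3.11)] -/
theorem mul_one_sub_probInf_le_pairCov (p q : Site 3) :
    0 ≤ 1 - (sourcedDoubleCurrentLawInf 3 (criticalBeta 3) ({0} ∆ {p}) ({e₂} ∆ {q})).real (openConn 0 e₂) ∧
    cc2 0 p * cc2 e₂ q *
        (1 - (sourcedDoubleCurrentLawInf 3 (criticalBeta 3) ({0} ∆ {p}) ({e₂} ∆ {q})).real (openConn 0 e₂)) ≤
      pairCov 0 e₂ p q := by
  -- adapted from Theorems/EnergyNotSigmaSquaredGapForcesFarMergingScreeningDecay.lean (`mul_one_sub_probInf_le`)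
  have hβ : 0 < criticalBeta 3 := criticalBeta_pos_holds (d := 3) (by norm_num)
  haveI := isProbabilityMeasure_sourcedDoubleCurrentLawInf (d := 3) hβ
    (even_card_singleton_symmDiff (0 : Site 3) p) (even_card_singleton_symmDiff e₂ q)
  haveI := isProbabilityMeasure_sourcedDoubleCurrentLawInf (d := 3) hβ
    (even_card_singleton_symmDiff (0 : Site 3) q) (even_card_singleton_symmDiff e₂ p)
  have hfac := energyFactorisation_criticalCorr 0 e₂ p q
  have hP1 : (sourcedDoubleCurrentLawInf 3 (criticalBeta 3) ({0} ∆ {p}) ({e₂} ∆ {q})).real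
      (openConn 0 e₂) ≤ 1 := measureReal_le_one
  have hP2 : (sourcedDoubleCurrentLawInf 3 (criticalBeta 3) ({0} ∆ {q}) ({e₂} ∆ {p})).real
      (openConn 0 e₂) ≤ 1 := measureReal_le_one
  have h3 : 0 ≤ criticalCorr 3 2 ![0, q] := (softPackageNoBubble_criticalCorr.pos 0 q).le
  have h4 : 0 ≤ criticalCorr 3 2 ![e₂, p] := (softPackageNoBubble_criticalCorr.pos e₂ p).le
  have hprod : 0 ≤ criticalCorr 3 2 ![0, q] * criticalCorr 3 2 ![e₂, p] *
      (1 - (sourcedDoubleCurrentLawInf 3 (criticalBeta 3) ({0} ∆ {q}) ({e₂} ∆ {p})).real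
        (openConn 0 e₂)) := mul_nonneg (mul_nonneg h3 h4) (by linarith)
  refine ⟨by linarith, ?_⟩
  unfold pairCov
  change criticalCorr 3 2 ![0, p] * criticalCorr 3 2 ![e₂, q] * _ ≤
    criticalCorr 3 4 ![0, e₂, p, q] - criticalCorr 3 2 ![0, e₂] * criticalCorr 3 2 ![p, q]
  linarith

/-! ## Steps (iii)–(iv): the infinite-volume bound inside a doubling window -/

/-- **GAP ⟹ the infinite-volume two-current avoidance of the one-pinch pair decays as a power along
doubling octaves**: inside a window `Doubling θ (K+1)`,
`1 - P^{0p,e₂q}_{β_c}[0 ↔ e₂] ≤ √(max(C,0)(1+θ⁻²)θ⁻⁸) · (2^{K+1})^{-κ/2}`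
(`p = p_{K+1}`, `q = q_{K+1}`). [cite: AizenmanDuminilCopinAnnals2021, eqs. (3.11) and (5.3)] -/
theorem one_sub_probInf_le {κ C θ : ℝ} (hθ : 0 < θ)
    (hC : ∀ x : Site 3, x ≠ 0 →
      criticalCorr 3 4 ![0, e₂, x, x + e₂] - criticalCorr 3 2 ![0, e₂] * criticalCorr 3 2 ![x, x + e₂] ≤
        C * (‖x‖ : ℝ) ^ (-κ) * criticalTwoPoint 3 x ^ 2)
    (K : ℕ) (hD : Doubling θ (K + 1)) :
    1 - (sourcedDoubleCurrentLawInf 3 (criticalBeta 3) ({0} ∆ {pFar (K + 1)}) ({e₂} ∆ {qFar (K + 1)})).real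
        (openConn 0 e₂) ≤
      Real.sqrt (max C 0 * (1 + θ⁻¹ ^ 2) * θ⁻¹ ^ 8) * ((2 : ℝ) ^ (K + 1)) ^ (-(κ / 2)) := by
  obtain ⟨hu0, hNu⟩ := mul_one_sub_probInf_le_pairCov (pFar (K + 1)) (qFar (K + 1))
  set u := 1 - (sourcedDoubleCurrentLawInf 3 (criticalBeta 3) ({0} ∆ {pFar (K + 1)})
    ({e₂} ∆ {qFar (K + 1)})).real (openConn 0 e₂) with hu
  have hg := G_pos (((2 : ℤ) ^ (K + 1)) • e₁)
  have hg₀ := G_pos (((2 : ℤ) ^ K) • e₁)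
  have hs : 0 < ((2 : ℝ) ^ (K + 1)) ^ (-(κ / 2)) := Real.rpow_pos_of_pos (by positivity) _
  have hs2 : (((2 : ℝ) ^ (K + 1)) ^ (-(κ / 2))) ^ 2 = ((2 : ℝ) ^ (K + 1)) ^ (-κ) := by
    rw [← Real.rpow_natCast, ← Real.rpow_mul (by positivity)]
    congr 1
    push_cast
    ring
  -- (i) RP + GAP + envelope
  obtain ⟨hE0, hE⟩ := envelope K
  have hgap := gap_at_dyadic hC (K + 1)
  have hRP := rp_pinch K
  -- the window: `θ g₀ ≤ g`, `θ² g ≤ g₃`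
  have hθg₀ : θ * G (((2 : ℤ) ^ K) • e₁) ≤ G (((2 : ℤ) ^ (K + 1)) • e₁) := hD K (by omega) (by omega)
  have hθg₁ : θ * G (((2 : ℤ) ^ (K + 1)) • e₁) ≤ G (((2 : ℤ) ^ (K + 2)) • e₁) :=
    hD (K + 1) (by omega) (by omega)
  have hθg₂ : θ * G (((2 : ℤ) ^ (K + 2)) • e₁) ≤ G (((2 : ℤ) ^ (K + 3)) • e₁) :=
    hD (K + 2) (by omega) (by omega)
  have hθ2g : θ ^ 2 * G (((2 : ℤ) ^ (K + 1)) • e₁) ≤ G (((2 : ℤ) ^ (K + 3)) • e₁) := by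
    nlinarith [mul_le_mul_of_nonneg_left hθg₁ hθ.le]
  -- MMS for the normalisers
  have hN₁ : G (((2 : ℤ) ^ (K + 3)) • e₁) ≤ cc2 0 (pFar (K + 1)) := by
    rw [cc2_eq_G, sub_zero]
    apply G_le_G
    rw [norm_two_pow_smul_e₁]
    calc 3 * ‖pFar (K + 1)‖ ≤ 3 * (2 : ℝ) ^ (K + 1) := by gcongr; exact norm_pFar_le (K + 1)
      _ ≤ 4 * 2 ^ (K + 1) := by gcongr; norm_num
      _ = 2 ^ (K + 3) := by ring
  have hN₂ : G (((2 : ℤ) ^ (K + 3)) • e₁) ≤ cc2 e₂ (qFar (K + 1)) := by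
    rw [cc2_eq_G]
    apply G_le_G
    rw [norm_two_pow_smul_e₁]
    calc 3 * ‖qFar (K + 1) - e₂‖ ≤ 3 * (2 : ℝ) ^ (K + 1) := by gcongr; exact norm_qFar_sub_e₂_le (K + 1)
      _ ≤ 4 * 2 ^ (K + 1) := by gcongr; norm_num
      _ = 2 ^ (K + 3) := by ring
  -- lower bound of the normalised avoidance: `θ⁴ g² u ≤ N₁ N₂ u ≤ t`
  have hg₃ : 0 ≤ G (((2 : ℤ) ^ (K + 3)) • e₁) := (G_pos _).le
  have hlow : θ ^ 4 * G (((2 : ℤ) ^ (K + 1)) • e₁) ^ 2 * u ≤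
      pairCov 0 e₂ (pFar (K + 1)) (qFar (K + 1)) := by
    refine le_trans ?_ hNu
    apply mul_le_mul_of_nonneg_right _ hu0
    have h2 : 0 ≤ θ ^ 2 * G (((2 : ℤ) ^ (K + 1)) • e₁) := by positivity
    calc θ ^ 4 * G (((2 : ℤ) ^ (K + 1)) • e₁) ^ 2
        = (θ ^ 2 * G (((2 : ℤ) ^ (K + 1)) • e₁)) * (θ ^ 2 * G (((2 : ℤ) ^ (K + 1)) • e₁)) := by ring
      _ ≤ G (((2 : ℤ) ^ (K + 3)) • e₁) * G (((2 : ℤ) ^ (K + 3)) • e₁) := mul_le_mul hθ2g hθ2g h2 hg₃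
      _ ≤ cc2 0 (pFar (K + 1)) * cc2 e₂ (qFar (K + 1)) := mul_le_mul hN₁ hN₂ hg₃ (hg₃.trans hN₁)
  -- upper bound of the truncation: `t² ≤ max(C,0) (1 + θ⁻²) s² g⁴`
  have hg₀' : G (((2 : ℤ) ^ K) • e₁) ≤ θ⁻¹ * G (((2 : ℤ) ^ (K + 1)) • e₁) := by
    rw [le_inv_mul_iff₀ hθ]; exact hθg₀
  have hup : pairCov 0 e₂ (pFar (K + 1)) (qFar (K + 1)) ^ 2 ≤
      max C 0 * (1 + θ⁻¹ ^ 2) * (((2 : ℝ) ^ (K + 1)) ^ (-(κ / 2))) ^ 2 *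
        G (((2 : ℤ) ^ (K + 1)) • e₁) ^ 4 := by
    have hA0 : 0 ≤ max C 0 * ((2 : ℝ) ^ (K + 1)) ^ (-κ) * G (((2 : ℤ) ^ (K + 1)) • e₁) ^ 2 := by
      have : 0 ≤ ((2 : ℝ) ^ (K + 1)) ^ (-κ) := Real.rpow_nonneg (by positivity) _
      positivity
    have h1 := hRP.trans (mul_le_mul hgap hE hE0 hA0)
    rw [hs2]
    have hsq : G (((2 : ℤ) ^ K) • e₁) ^ 2 ≤ (θ⁻¹ * G (((2 : ℤ) ^ (K + 1)) • e₁)) ^ 2 :=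
      pow_le_pow_left₀ hg₀.le hg₀' 2
    have hr : 0 ≤ ((2 : ℝ) ^ (K + 1)) ^ (-κ) := Real.rpow_nonneg (by positivity) _
    calc pairCov 0 e₂ (pFar (K + 1)) (qFar (K + 1)) ^ 2
        ≤ max C 0 * ((2 : ℝ) ^ (K + 1)) ^ (-κ) * G (((2 : ℤ) ^ (K + 1)) • e₁) ^ 2 *
            (G (((2 : ℤ) ^ (K + 1)) • e₁) ^ 2 + G (((2 : ℤ) ^ K) • e₁) ^ 2) := h1
      _ ≤ max C 0 * ((2 : ℝ) ^ (K + 1)) ^ (-κ) * G (((2 : ℤ) ^ (K + 1)) • e₁) ^ 2 *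
            (G (((2 : ℤ) ^ (K + 1)) • e₁) ^ 2 + (θ⁻¹ * G (((2 : ℤ) ^ (K + 1)) • e₁)) ^ 2) := by
          gcongr
      _ = max C 0 * (1 + θ⁻¹ ^ 2) * ((2 : ℝ) ^ (K + 1)) ^ (-κ) * G (((2 : ℤ) ^ (K + 1)) • e₁) ^ 4 := by
          ring
  -- combine: `(θ⁴ g² u)² ≤ t² ≤ M s² g⁴`, divide by `θ⁸ g⁴`
  have hlow0 : 0 ≤ θ ^ 4 * G (((2 : ℤ) ^ (K + 1)) • e₁) ^ 2 * u := by positivity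
  have hsq := (pow_le_pow_left₀ hlow0 hlow 2).trans hup
  set D := Real.sqrt (max C 0 * (1 + θ⁻¹ ^ 2) * θ⁻¹ ^ 8) with hDdef
  have hD0 : 0 ≤ D := Real.sqrt_nonneg _
  have hD2 : D ^ 2 = max C 0 * (1 + θ⁻¹ ^ 2) * θ⁻¹ ^ 8 := Real.sq_sqrt (by positivity)
  have key : u ^ 2 ≤ (D * ((2 : ℝ) ^ (K + 1)) ^ (-(κ / 2))) ^ 2 := by
    rw [mul_pow, hD2]
    have hc : 0 < θ ^ 8 * G (((2 : ℤ) ^ (K + 1)) • e₁) ^ 4 := by positivity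
    have h1 : u ^ 2 * (θ ^ 8 * G (((2 : ℤ) ^ (K + 1)) • e₁) ^ 4) ≤
        max C 0 * (1 + θ⁻¹ ^ 2) * (((2 : ℝ) ^ (K + 1)) ^ (-(κ / 2))) ^ 2 *
          G (((2 : ℤ) ^ (K + 1)) • e₁) ^ 4 :=
      calc u ^ 2 * (θ ^ 8 * G (((2 : ℤ) ^ (K + 1)) • e₁) ^ 4)
          = (θ ^ 4 * G (((2 : ℤ) ^ (K + 1)) • e₁) ^ 2 * u) ^ 2 := by ring
        _ ≤ _ := hsq
    refine ((le_div_iff₀ hc).2 h1).trans (le_of_eq ?_)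
    field_simp
  exact le_of_pow_le_pow_left₀ two_ne_zero (by positivity) key

end OnePinchDecayProof

open scoped symmDiff
open MeasureTheory Filter
open Literature.Probability.LatticeModels Literature.Probability.Percolation
open Summit.CriticalPhenomena.Ising3DConformalLimit.GapForcesFarMergingSandwich
open Summit.CriticalPhenomena.Ising3DConformalLimit.Theses.EnergyNotSigmaSquared

/-- **Infinite-volume one-pinch bound from GAP (helper of `stub_onePinchDecay`).** Under
`EnergyGapPowerLaw` (exponent `κ`), for every window constant `θ > 0` there are `κ' = κ/2 > 0` and `D`
such that at every octave `K ≥ 1` carrying a doubling window `Doubling θ K`, the infinite-volume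
two-current avoidance probability of the one-pinch pair `(0, p_K)`, `(e₂, q_K)` satisfies
`1 - P^{0p_K, e₂q_K}_{β_c}[0 ↔ e₂] ≤ D · (2^K)^{-κ'}` (RP un-pinching + GAP + Lebowitz/MMS envelope +
energy factorisation + MMS inside the window). [cite: AizenmanDuminilCopinAnnals2021, eqs. (3.11) and (5.3)] [cite: FILS1978, Thm. 2.1] -/
theorem onePinchDecay_one_sub_probInf_le :
    EnergyGapPowerLaw → ∀ θ : ℝ, 0 < θ → ∃ κ D : ℝ, 0 < κ ∧ ∀ K : ℕ, 1 ≤ K → Doubling θ K →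
      1 - (sourcedDoubleCurrentLawInf 3 (criticalBeta 3) ({0} ∆ {pFar K}) ({e₂} ∆ {qFar K})).real
          (openConn 0 e₂) ≤ D * ((2 : ℝ) ^ K) ^ (-κ) := by
  intro hGAP θ hθ
  obtain ⟨κ, C, hκ, hC⟩ := hGAP
  refine ⟨κ / 2, Real.sqrt (max C 0 * (1 + θ⁻¹ ^ 2) * θ⁻¹ ^ 8), by positivity, fun K hK hD => ?_⟩
  obtain ⟨K, rfl⟩ : ∃ K', K = K' + 1 := ⟨K - 1, by omega⟩
  exact OnePinchDecayProof.one_sub_probInf_le hθ hC K hD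

end Summit.CriticalPhenomena.Ising3DConformalLimit.EnergyNotSigmaSquaredGapForcesFarMergingSandwich

end
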